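import Mathlib
import Summits.ValiantsHypothesis.ValiantsHypothesis.Theorems.NewtonUnitEquationsDissociatedUniformTotalsLawStaircase
import Summits.ValiantsHypothesis.ValiantsHypothesis.Theorems.NewtonUnitEquationsDissociatedUniformTotalsLawIntervalUnionLinear
import Literature.Computability.AlgebraicComplexity.NewtonPolygonTauProductBounds
import HarnessLib

/-!
# Crux `NewtonUnitEquations.DissociatedUniform` (stmt-ValiantsHypothesis-5905), `n = 3` totals law of model (Q**):
# unions of translated windows of one length with FAT columns (each label a finite point set) — linear hull bound

Tool file for `…TotalsLawIntervalUnionBands`.  `…TotalsLawIntervalUnionLinear.ncard_extremePoints_windows_le_linear` bounds the hull of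
`⋃_i (v i + b[l_i, l_i + m))` for a point sequence `b`; here every label `n` carries a FINITE SET of points `pt(B n)`:
* `ncard_extremePoints_fatWindows_le`: `#vert conv ⋃_i (v i + ⋃_{n∈[l_i,l_i+m)} pt(B n)) ≤ 8|ι| + 8 Σ_{n<(N/m+2)m} #B n`
  (`l_i < N`).
Same block decomposition (`fatWindows_eq_biUnion`: suffix and prefix staircases per block of `m` labels, `fatSuf`, `fatPre`) with FAT
COLUMNS `(c, y)`, `y ∈ B(tm + c)` (`fatCols`), whose positions `fatColPos` refine the column position of `c` by a code of `y`, so that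
positions stay injective and comparisons with the (rescaled) row positions `fatRowPos` only see `c`
(`fatRowPos_lt_fatColPos_iff`, `fatColPos_lt_fatRowPos_iff`); then the staircase hull bound
`…TotalsLawStaircase.Stair.ncard_extremePoints_stairPts_le` applies verbatim and each block of labels is paid twice.
Honest label: elementary convex geometry; nothing here bears on VP ≠ VNP. [folklore]
-/

set_option linter.dupNamespace false -- `ValiantsHypothesis.ValiantsHypothesis` (summit = problem) in every name

open Finset
open scoped Pointwise

namespace Summit.ValiantsHypothesis.ValiantsHypothesis.Theorems.NewtonUnitEquationsDissociatedUniform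

namespace TotalsLaw

open Literature.Computability.AlgebraicComplexity.KPTT.PlanarMinkowski

/-! ### Windows of one length with FAT columns (each label a finite set of points) -/

section FatWindows

variable {ι π : Type*} [Fintype ι] [Fintype π]

/-- Row positions, rescaled to make room for the point code of fat columns. -/
noncomputable def fatRowPos (π : Type*) [Fintype π] (l : ι → ℕ) (m : ℕ) (i : ι) : ℕ :=
  (Fintype.card π + 1) * winRowPos l m i

/-- Column positions of fat columns `(c, y)`: the code of the point `y` plus the rescaled column position of `c`. -/
noncomputable def fatColPos (ι π : Type*) [Fintype ι] [Fintype π] (p : ℕ × π) : ℕ :=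
  (Fintype.equivFin π p.2 : ℕ) + (Fintype.card π + 1) * winColPos ι p.1

/-- Row and column positions never coincide. [folklore] -/
theorem winRowPos_ne_winColPos (l : ι → ℕ) (m : ℕ) (i : ι) (c : ℕ) : winRowPos l m i ≠ winColPos ι c := by
  intro h
  have h1 := winRowPos_lt_winColPos_iff l m i c
  have h2 := winColPos_lt_winRowPos_iff l m i c
  rw [h] at h1 h2
  simp only [lt_self_iff_false, false_iff, not_le, not_lt] at h1 h2
  omega

omit [Fintype ι] [Fintype π] in
/-- Rescaled comparison, I. [folklore] -/
private theorem scaled_lt_iff {P a b k : ℕ} (hk : k < P) (hab : a ≠ b) : P * a < k + P * b ↔ a < b := by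
  constructor
  · intro h
    by_contra hc
    have hba : b < a := lt_of_le_of_ne (not_lt.1 hc) (Ne.symm hab)
    have h1 : P * (b + 1) ≤ P * a := Nat.mul_le_mul_left _ hba
    rw [mul_add, mul_one] at h1
    omega
  · intro h
    have h1 : P * (a + 1) ≤ P * b := Nat.mul_le_mul_left _ h
    rw [mul_add, mul_one] at h1
    omega

omit [Fintype ι] [Fintype π] in
/-- Rescaled comparison, II. [folklore] -/
private theorem scaled_lt_iff' {P a b k : ℕ} (hk : k < P) (hab : a ≠ b) : k + P * b < P * a ↔ b < a := by
  constructor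
  · intro h
    by_contra hc
    have hab' : a < b := lt_of_le_of_ne (not_lt.1 hc) hab
    have h1 : P * (a + 1) ≤ P * b := Nat.mul_le_mul_left _ hab'
    rw [mul_add, mul_one] at h1
    omega
  · intro h
    have h1 : P * (b + 1) ≤ P * a := Nat.mul_le_mul_left _ h
    rw [mul_add, mul_one] at h1
    omega

/-- `fatRowPos i < fatColPos (c, y) ↔ l i mod m ≤ c`. [folklore] -/
theorem fatRowPos_lt_fatColPos_iff (l : ι → ℕ) (m : ℕ) (i : ι) (p : ℕ × π) :
    fatRowPos π l m i < fatColPos ι π p ↔ l i % m ≤ p.1 := by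
  unfold fatRowPos fatColPos
  rw [scaled_lt_iff (by have := (Fintype.equivFin π p.2).isLt; omega) (winRowPos_ne_winColPos l m i p.1),
    winRowPos_lt_winColPos_iff]

/-- `fatColPos (c, y) < fatRowPos i ↔ c < l i mod m`. [folklore] -/
theorem fatColPos_lt_fatRowPos_iff (l : ι → ℕ) (m : ℕ) (i : ι) (p : ℕ × π) :
    fatColPos ι π p < fatRowPos π l m i ↔ p.1 < l i % m := by
  unfold fatRowPos fatColPos
  rw [scaled_lt_iff' (by have := (Fintype.equivFin π p.2).isLt; omega) (winRowPos_ne_winColPos l m i p.1),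
    winColPos_lt_winRowPos_iff]

/-- Fat row positions are injective. [folklore] -/
theorem fatRowPos_injective (l : ι → ℕ) (m : ℕ) : Function.Injective (fatRowPos π l m) := fun _ _ h =>
  winRowPos_injective l m (Nat.eq_of_mul_eq_mul_left (by omega) h)

/-- Fat column positions are injective. [folklore] -/
theorem fatColPos_injective (ι π : Type*) [Fintype ι] [Fintype π] : Function.Injective (fatColPos ι π) := by
  intro p p' h
  unfold fatColPos at h
  have hk := (Fintype.equivFin π p.2).isLt
  have hk' := (Fintype.equivFin π p'.2).isLt
  have h1 : (Fintype.equivFin π p.2 : ℕ) = (Fintype.equivFin π p'.2 : ℕ) := by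
    have := congrArg (· % (Fintype.card π + 1)) h
    simp only [Nat.add_mul_mod_self_left] at this
    rwa [Nat.mod_eq_of_lt (by omega : (Fintype.equivFin π p.2 : ℕ) < Fintype.card π + 1),
      Nat.mod_eq_of_lt (by omega : (Fintype.equivFin π p'.2 : ℕ) < Fintype.card π + 1)] at this
  have h2 : (Fintype.card π + 1) * winColPos ι p.1 = (Fintype.card π + 1) * winColPos ι p'.1 := by omega
  exact Prod.ext (winColPos_injective ι (Nat.eq_of_mul_eq_mul_left (by omega) h2))
    ((Fintype.equivFin π).injective (Fin.ext h1))

/-- The FAT COLUMNS of block `t`: pairs `(c, y)` with `c < m` and `y` in the label set `B (tm + c)`. -/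
noncomputable def fatCols [DecidableEq π] (B : ℕ → Finset π) (m t : ℕ) : Finset (ℕ × π) :=
  (Finset.range m).biUnion fun c => (B (t * m + c)).image fun y => (c, y)

omit [Fintype ι] [Fintype π] in
/-- Membership in `fatCols`. [folklore] -/
theorem mem_fatCols [DecidableEq π] {B : ℕ → Finset π} {m t : ℕ} {p : ℕ × π} :
    p ∈ fatCols B m t ↔ p.1 < m ∧ p.2 ∈ B (t * m + p.1) := by
  classical
  constructor
  · intro h
    obtain ⟨c, hc, hp⟩ := Finset.mem_biUnion.1 h
    obtain ⟨y, hy, rfl⟩ := Finset.mem_image.1 hp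
    exact ⟨Finset.mem_range.1 hc, hy⟩
  · rintro ⟨h1, h2⟩
    exact Finset.mem_biUnion.2 ⟨p.1, Finset.mem_range.2 h1, Finset.mem_image.2 ⟨p.2, h2, rfl⟩⟩

omit [Fintype ι] [Fintype π] in
/-- `#fatCols ≤ Σ_c #B(tm + c)`. [folklore] -/
theorem card_fatCols_le [DecidableEq π] (B : ℕ → Finset π) (m t : ℕ) :
    (fatCols B m t).card ≤ ∑ c ∈ Finset.range m, (B (t * m + c)).card := by
  classical
  unfold fatCols
  exact Finset.card_biUnion_le.trans (Finset.sum_le_sum fun c _ => Finset.card_image_le)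

/-- The fat SUFFIX staircase of block `t`. -/
noncomputable def fatSuf [DecidableEq π] (pt : π → (Fin 2 → ℝ)) (B : ℕ → Finset π) (v : ι → (Fin 2 → ℝ)) (l : ι → ℕ) (m t : ℕ) :
    Finset (Fin 2 → ℝ) :=
  Stair.stairPts (winRows l m t) (fatCols B m t) (fatRowPos π l m) (fatColPos ι π) v fun p => pt p.2

/-- The fat PREFIX staircase of block `t + 1`. -/
noncomputable def fatPre [DecidableEq π] (pt : π → (Fin 2 → ℝ)) (B : ℕ → Finset π) (v : ι → (Fin 2 → ℝ)) (l : ι → ℕ) (m t : ℕ) :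
    Finset (Fin 2 → ℝ) :=
  Stair.stairPts (fatCols B m (t + 1)) (winRows l m t) (fatColPos ι π) (fatRowPos π l m) (fun p => pt p.2) v

/-- **Block decomposition with fat columns:** a union of translated windows of ONE LENGTH of a sequence of FINITE POINT SETS is the
union over blocks of a fat suffix staircase and a fat prefix staircase. [folklore] -/
theorem fatWindows_eq_biUnion [DecidableEq π] (pt : π → (Fin 2 → ℝ)) (B : ℕ → Finset π) (v : ι → (Fin 2 → ℝ)) (l : ι → ℕ)
    (m N : ℕ) (hl : ∀ i, l i < N) :
    (⋃ i, (v i +ᵥ ⋃ n ∈ Set.Ico (l i) (l i + m), (pt '' (B n : Set π)))) =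
      (((Finset.range (N / m + 1)).biUnion fun t => fatSuf pt B v l m t ∪ fatPre pt B v l m t : Finset (Fin 2 → ℝ)) :
        Set (Fin 2 → ℝ)) := by
  classical
  ext z
  simp only [Set.mem_iUnion, Finset.coe_biUnion, Finset.mem_coe, Finset.mem_union]
  constructor
  · rintro ⟨i, hz⟩
    rw [Set.mem_vadd_set] at hz
    obtain ⟨w, hw, rfl⟩ := hz
    rw [Set.mem_iUnion₂] at hw
    obtain ⟨n, ⟨hn1, hn2⟩, hw⟩ := hw
    obtain ⟨y, hy, rfl⟩ := hw
    rw [Finset.mem_coe] at hy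
    have hm : 0 < m := by omega
    set t := l i / m with ht
    have hdiv : t * m + l i % m = l i := by rw [ht]; exact Nat.div_add_mod' (l i) m
    have hr : l i % m < m := Nat.mod_lt _ hm
    refine ⟨t, Finset.mem_range.2 (Nat.lt_succ_of_le (Nat.div_le_div_right (hl i).le)), ?_⟩
    have hrow : i ∈ winRows l m t := Finset.mem_filter.2 ⟨Finset.mem_univ _, rfl⟩
    by_cases hnt : n < t * m + m
    · left
      refine Stair.mem_stairPts.2 ⟨i, hrow, (n - t * m, y), mem_fatCols.2 ⟨by simp only; omega, ?_⟩, ?_, ?_⟩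
      · simp only
        rwa [show t * m + (n - t * m) = n by omega]
      · rw [fatRowPos_lt_fatColPos_iff]; simp only; omega
      · exact (vadd_eq_add _ _).symm
    · right
      push Not at hnt
      refine Stair.mem_stairPts.2 ⟨(n - (t * m + m), y), mem_fatCols.2 ⟨by simp only; omega, ?_⟩, i, hrow, ?_, ?_⟩
      · simp only
        rwa [show (t + 1) * m + (n - (t * m + m)) = n by rw [add_mul, one_mul]; omega]
      · rw [fatColPos_lt_fatRowPos_iff]; simp only; omega
      · rw [vadd_eq_add, add_comm]
  · rintro ⟨t, -, h | h⟩
    · obtain ⟨i, hi, p, hp, hlt, rfl⟩ := Stair.mem_stairPts.1 h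
      rw [fatRowPos_lt_fatColPos_iff] at hlt
      obtain ⟨hp1, hp2⟩ := mem_fatCols.1 hp
      obtain ⟨-, hit⟩ := Finset.mem_filter.1 hi
      have hm : 0 < m := by omega
      have hdiv : t * m + l i % m = l i := by rw [← hit]; exact Nat.div_add_mod' (l i) m
      have hr : l i % m < m := Nat.mod_lt _ hm
      refine ⟨i, ?_⟩
      rw [Set.mem_vadd_set]
      refine ⟨pt p.2, ?_, vadd_eq_add _ _⟩
      rw [Set.mem_iUnion₂]
      exact ⟨t * m + p.1, ⟨by omega, by omega⟩, ⟨p.2, Finset.mem_coe.2 hp2, rfl⟩⟩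
    · obtain ⟨p, hp, i, hi, hlt, rfl⟩ := Stair.mem_stairPts.1 h
      rw [fatColPos_lt_fatRowPos_iff] at hlt
      obtain ⟨hp1, hp2⟩ := mem_fatCols.1 hp
      obtain ⟨-, hit⟩ := Finset.mem_filter.1 hi
      have hm : 0 < m := by omega
      have hdiv : t * m + l i % m = l i := by rw [← hit]; exact Nat.div_add_mod' (l i) m
      have hr : l i % m < m := Nat.mod_lt _ hm
      refine ⟨i, ?_⟩
      rw [Set.mem_vadd_set]
      refine ⟨pt p.2, ?_, by rw [vadd_eq_add, add_comm]⟩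
      rw [Set.mem_iUnion₂]
      refine ⟨(t + 1) * m + p.1, ⟨?_, ?_⟩, ⟨p.2, Finset.mem_coe.2 hp2, rfl⟩⟩
      · rw [add_mul, one_mul]; omega
      · rw [add_mul, one_mul]; omega

/-- `#vert conv (S ∪ P) ≤ #vert conv S + #vert conv P` for finite planar sets. [folklore] -/
private theorem ncard_extremePoints_union_le' (S P : Finset (Fin 2 → ℝ)) :
    ((convexHull ℝ ((S ∪ P : Finset (Fin 2 → ℝ)) : Set (Fin 2 → ℝ))).extremePoints ℝ).ncard ≤
      ((convexHull ℝ (S : Set (Fin 2 → ℝ))).extremePoints ℝ).ncard +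
        ((convexHull ℝ (P : Set (Fin 2 → ℝ))).extremePoints ℝ).ncard := by
  classical
  have h := ncard_extremePoints_biUnion_le ({0, 1} : Finset ℕ) (fun k => if k = 0 then S else P)
  have h1 : (({0, 1} : Finset ℕ).biUnion fun k => if k = 0 then S else P) = S ∪ P := by
    rw [Finset.biUnion_insert, Finset.singleton_biUnion, if_pos rfl, if_neg Nat.one_ne_zero]
  rw [h1, Finset.sum_insert (by simp), Finset.sum_singleton, if_pos rfl, if_neg Nat.one_ne_zero] at h
  exact h

omit [Fintype ι] [Fintype π] in
/-- Re-indexing a double sum over blocks as a single sum. [folklore] -/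
private theorem sum_range_blocks (g : ℕ → ℕ) (m : ℕ) : ∀ T : ℕ,
    ∑ t ∈ Finset.range T, ∑ c ∈ Finset.range m, g (t * m + c) = ∑ n ∈ Finset.range (T * m), g n := by
  intro T
  induction T with
  | zero => simp
  | succ T ih => rw [Finset.sum_range_succ, ih, add_mul, one_mul, Finset.sum_range_add]

/-- **Unions of translated windows of one length of a sequence of finite point sets, LINEAR bound:**
`#vert conv ⋃ i (v i + ⋃_{n ∈ [l i, l i + m)} pt(B n)) ≤ 8·|ι| + 8·Σ_{n < (N/m + 2)m} #B n`. [folklore] -/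
theorem ncard_extremePoints_fatWindows_le [DecidableEq π] (pt : π → (Fin 2 → ℝ)) (B : ℕ → Finset π) (v : ι → (Fin 2 → ℝ))
    (l : ι → ℕ) (m N : ℕ) (hl : ∀ i, l i < N) :
    (Set.extremePoints ℝ (convexHull ℝ (⋃ i, (v i +ᵥ ⋃ n ∈ Set.Ico (l i) (l i + m), (pt '' (B n : Set π)))))).ncard ≤
      8 * Fintype.card ι + 8 * ∑ n ∈ Finset.range ((N / m + 2) * m), (B n).card := by
  classical
  rw [fatWindows_eq_biUnion pt B v l m N hl]
  refine (ncard_extremePoints_biUnion_le _ _).trans ?_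
  have hpiece : ∀ t ∈ Finset.range (N / m + 1),
      ((convexHull ℝ ((fatSuf pt B v l m t ∪ fatPre pt B v l m t : Finset (Fin 2 → ℝ)) : Set (Fin 2 → ℝ))).extremePoints
          ℝ).ncard ≤ 8 * (winRows l m t).card + (4 * (fatCols B m t).card + 4 * (fatCols B m (t + 1)).card) := by
    intro t _
    have hS : ((convexHull ℝ (fatSuf pt B v l m t : Set (Fin 2 → ℝ))).extremePoints ℝ).ncard ≤
        4 * ((winRows l m t).card + (fatCols B m t).card) :=
      Stair.ncard_extremePoints_stairPts_le (R := winRows l m t) (C := fatCols B m t) (v := v)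
        (b := fun p : ℕ × π => pt p.2) (fatRowPos_injective l m) (fatColPos_injective ι π)
    have hP : ((convexHull ℝ (fatPre pt B v l m t : Set (Fin 2 → ℝ))).extremePoints ℝ).ncard ≤
        4 * ((fatCols B m (t + 1)).card + (winRows l m t).card) :=
      Stair.ncard_extremePoints_stairPts_le (R := fatCols B m (t + 1)) (C := winRows l m t)
        (v := fun p : ℕ × π => pt p.2) (b := v) (fatColPos_injective ι π) (fatRowPos_injective l m)
    have hU := ncard_extremePoints_union_le' (fatSuf pt B v l m t) (fatPre pt B v l m t)
    omega
  refine (Finset.sum_le_sum hpiece).trans ?_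
  have hrows : ∑ t ∈ Finset.range (N / m + 1), (winRows l m t).card ≤ Fintype.card ι := by
    rw [← Finset.card_univ, Finset.card_eq_sum_card_fiberwise (s := Finset.univ) (t := Finset.range (N / m + 1))
      (f := fun i => l i / m) (fun i _ => Finset.mem_coe.2 (Finset.mem_range.2
        (Nat.lt_succ_of_le (Nat.div_le_div_right (hl i).le))))]
    unfold winRows
    exact le_rfl
  -- the fat column counts: each block is used at most twice
  have hC : ∀ t, (fatCols B m t).card ≤ ∑ c ∈ Finset.range m, (B (t * m + c)).card := card_fatCols_le B m
  have h1 : ∑ t ∈ Finset.range (N / m + 1), (fatCols B m t).card ≤ ∑ n ∈ Finset.range ((N / m + 2) * m), (B n).card := by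
    calc _ ≤ ∑ t ∈ Finset.range (N / m + 1), ∑ c ∈ Finset.range m, (B (t * m + c)).card := Finset.sum_le_sum fun t _ => hC t
      _ = ∑ n ∈ Finset.range ((N / m + 1) * m), (B n).card := sum_range_blocks (fun n => (B n).card) m _
      _ ≤ ∑ n ∈ Finset.range ((N / m + 2) * m), (B n).card :=
          Finset.sum_le_sum_of_subset (Finset.range_mono (Nat.mul_le_mul_right m (by omega)))
  have h2 : ∑ t ∈ Finset.range (N / m + 1), (fatCols B m (t + 1)).card ≤
      ∑ n ∈ Finset.range ((N / m + 2) * m), (B n).card := by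
    calc _ ≤ ∑ t ∈ Finset.range (N / m + 2), (fatCols B m t).card := by
          rw [Finset.sum_range_succ' (fun t => (fatCols B m t).card) (N / m + 1)]
          exact Nat.le_add_right _ _
      _ ≤ ∑ t ∈ Finset.range (N / m + 2), ∑ c ∈ Finset.range m, (B (t * m + c)).card :=
          Finset.sum_le_sum fun t _ => hC t
      _ = ∑ n ∈ Finset.range ((N / m + 2) * m), (B n).card := sum_range_blocks (fun n => (B n).card) m _
  have hsum : ∑ t ∈ Finset.range (N / m + 1),
      (8 * (winRows l m t).card + (4 * (fatCols B m t).card + 4 * (fatCols B m (t + 1)).card)) =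
      8 * ∑ t ∈ Finset.range (N / m + 1), (winRows l m t).card +
        (4 * ∑ t ∈ Finset.range (N / m + 1), (fatCols B m t).card +
          4 * ∑ t ∈ Finset.range (N / m + 1), (fatCols B m (t + 1)).card) := by
    rw [Finset.sum_add_distrib, Finset.sum_add_distrib, Finset.mul_sum, Finset.mul_sum, Finset.mul_sum]
  rw [hsum]
  have := Nat.mul_le_mul_left 8 hrows
  omega

end FatWindows


end TotalsLaw

end Summit.ValiantsHypothesis.ValiantsHypothesis.Theorems.NewtonUnitEquationsDissociatedUniform
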